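import Summits.QuantumFields.BalabanUV.T4Continuum.Support.B13StepOfRecordActNorm
import Summits.QuantumFields.BalabanUV.T4Continuum.Support.B13StepEndOn

/-!
# B13TermRepLoc — NE5 ∕ U3, row O1-d3 (TERM REP) follower: the R21 «Loc twin» of `B13TermRep` AT ACTIVITY LEVEL — the per-DOMAIN
# termwise binders `TermBoundLoc` ∕ `TermBudgetLoc` of the owner's `OutputRateTermwiseLoc` for the B13 term family from a
# (g,U)-UNIFORM ACTIVITY MAJORANT ((2.38)-KIND) and its ANCHORED NORM, on any socket and on Bałaban's carriers of record, and the
# fully-local END face of record E1 (`B13StepEndOn.ne5_of_record_restrict_loc`) FIRED FROM THEM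
# (cell `pub-balaban`, T⁴ fan-out, `HOME/BINDER-OWNERS.md` row NE5; unit `b2b-balaban-t4-ne5-formalise-leaf-04`, gen 2; journal INTENT l.12703)

HONEST FRAMING (T4-DAG PAGE 1).  Rung (B)+1 on ONE finite four-torus of fixed physical size — NOT infinite volume, NOT a mass gap, NOT
the Clay problem; `FlowStep.BetaPertH`, (B), (B^μ) do not occur here.  NE5 (`T4OutputRate.NE5`) is NOT PRINTED and NOT PROVED (spine
0/9, unchanged); every END below is an IMPLICATION from displayed binders.  Nothing of the manuscripts under audit is asserted; 0 cite
tags; printed KIND only: [II] = [Balaban1988RG2Cluster] Lemma 3 (2.38) p. 20 (activity bound per localized term), (2.39)–(2.41) p. 21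
(the sum over the terms `(Z₁,…,Zₙ)` with `∪Zᵢ = X` AT FIXED `X`, decay extracted by (2.27)∕(2.40)).  HONEST DEPENDENCY (cell, verbatim):
continuum YM on T⁴ ⇐ BetaPertH ∧ nine spine estimates (0/9 proved); BetaPertH ⇐ (D1) ∧ (D4) ∧ CAP+tail; G-an2-4 gates asym, D1 and
NE2/3/4.

WHY (owner ruling R21, journal l.11315; R32, l.12675).  The termwise END faces displayed `TermBound K T W κ a` ∕ `TermBudget a G` with an
X-BLIND weight `a : ℕ → ι → ℝ`; with absolute term labels `Σ' i, a k i` runs over every localized term of the torus — volume-extensive.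
R21's remedy are the per-DOMAIN shapes `TermBoundLoc K T W κ a` (`‖T k i q X‖ ≤ a k i X·e^{−κd X}`) and `TermBudgetLoc a G` (`Σ' i, a k i X
≤ G` at every step-`k` domain `X`), consumed by leaf-09's E1 re-pointing `B13StepEndOn` ∕ `B13StepEndLoc`.  Row O1-d3's split
(`B13TermRep.actMajorant`: zero off the localization relation, `‖coeff i‖·Π_m A (poly i m) (lab i m)` on it) ALREADY carries the domain
`X`; this module reads it as the R21 weight `a k i X := actMajorant 𝒯 inc (A k) k X i · e^{κd X}` for a (g,U)-UNIFORM activity majorant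
`A k` and supplies BOTH displayed binders R32 names for the factor-core END («keep `hmaj : actMajorant … ≤ a k i X·e^{−κd X}` and
`TermBudgetLoc a G` DISPLAYED and SEPARATE») from the activity-majorant currency: `hmaj` with equality, `TermBudgetLoc` from the
anchored exponential norm of a stripped majorant (`36Φ′ < 1`) through leaf-08's Ursell engine — the g-blind, W-free twin of leaf-01's
`B13StepOfRecordActNorm.actBudget_record_of_actNormDecay`.

WHAT THIS MODULE IS (bookkeeping ∕ [folklore]; 0 new definitions; all conclusions are the tree's shapes BY NAME):
* §1 GENERIC (`𝒯 inc act`, class `K`): `termBoundLoc_b13_of_actBound` (uniform activity majorant ⟹ `TermBoundLoc K (term 𝒯 inc act) W κ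
  (fun k i X => actMajorant 𝒯 inc (A k) k X i * exp (κ·d X))`), `actMajorant_eq_weight_mul` ∕ `actMajorant_le_weight` (R32's `hmaj` for this
  weight), `termBudgetLoc_of_actBudgetDecay` (per-domain summability + `Σ' ≤ G·e^{−κd X}` ⟹ `TermBudgetLoc (…) G`).
* §2 ON THE CARRIERS OF RECORD: `actBudget_record_of_actNormDecayU` (g-blind, W-free twin of leaf-01's N71 face: nonnegative `A, A′`, split
  `A k ≤ A′ k·e^{−κ(d(Z)+5)}`, anchored norm of `A′ k` on `R.domAt k` ≤ Φ′, `36Φ′ < 1` ⟹ per-domain summability + `Σ' ≤ (Φ′∕(1−36Φ′))·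
  e^{−κd X}`; footprint locality, reach ν = 9 and (2.27) c = 5 DISCHARGED by `B13DomainGeometryTR.loc_b13` ∕ `reach_b13` ∕ `ineq227_level`)
  ⟹ `termBudgetLoc_record_of_actNormDecayU`.
* §3 END `ne5_of_record_restrict_loc_actNorm`: leaf-09's FULLY-LOCAL `B13StepEndOn.ne5_of_record_restrict_loc` (E1 on the record sub-slot
  `restrict S M hMA hMB`, per-domain termwise data) with `hbd` ∕ `hbud` DISCHARGED from a (g,U)-uniform activity majorant of `S.act`
  DISPLAYED ON THE RECORD CLASS `ballClass (selfCtr (assembly S).raw (assembly S).histRef) ROp RHist` (moved to the sub-slot class by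
  `mem_ballClass_onSub_iff` + `restrict_act`), its split and the anchored norm — `G := Φ′∕(1 − 36Φ′)`; the analyticity half
  `TermLineAnalytic`, the insertion binders `hbA`∕`hbB`∕`hins`, W1, levels, rooms, numerics displayed AS THERE; conclusion LITERALLY
  `NE5 (B13StepOfRecord.outA S E₀ cB) (B13StepOfRecord.outB S E₀ cB) W κ θ′ C₅`.
STATUS (census, Edison rule).  Discharges NO estimate of [II]: the (2.38)-KIND majorant, the smallness of its anchored norm, analyticity,
W1∕W3∕W4, levels, numerics stay displayed; what changes is that E1's termwise MAJORANT half on the record reads, per DOMAIN, from the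
SAME activity-level currency as E8[rec] (N74∕N111) and E9[rec] (N116) — volume-uniform `G`.  NE5 NOT PROVED; 0/12 leaves on Bałaban's
concrete objects; spine 0/9; rung (B)+1 finite T⁴; NOT infinite volume ∕ mass gap ∕ Clay.  0 sorry; axioms ⊆ {propext, Classical.choice,
Quot.sound}.
-/

noncomputable section

open scoped BigOperators

namespace Summit.QuantumFields.BalabanUV.T4Continuum.B13TermRepLoc

open Literature.MathematicalPhysics.QuantumFieldTheory.Balaban1983to89
open Literature.MathematicalPhysics.QuantumFieldTheory.Balaban1983to89.T4OutputRate (Carriers Functional DecayBound NE5)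
open Literature.MathematicalPhysics.QuantumFieldTheory.Balaban1983to89.T4InputCauchyRateData (StepModel)
open Literature.MathematicalPhysics.QuantumFieldTheory.Balaban1983to89.T4InputCauchyRateSpecies (ballClass)
open Literature.MathematicalPhysics.QuantumFieldTheory.Balaban1983to89.T4InputCauchyRateTermwise (TermLineAnalytic)
open Summit.QuantumFields.BalabanUV.T4Continuum.B13Carriers (TwoRuns)
open Summit.QuantumFields.BalabanUV.T4Continuum.B13OpDatum (OpDatum)
open Summit.QuantumFields.BalabanUV.T4Continuum.B13OpDatumJunctions (opOf RawBounded WeightedEntrywiseRate)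
open Summit.QuantumFields.BalabanUV.T4Continuum.B13StepTermLabels (TermIdx InnerLabel)
open Summit.QuantumFields.BalabanUV.T4Continuum.B13StepTermFamily (TermIndexing term)
open Summit.QuantumFields.BalabanUV.T4Continuum.B13StepTermSocket (labelsIndexing touchInc)
open Summit.QuantumFields.BalabanUV.T4Continuum.B13InnerData (Bnd b13InnerData)
open Summit.QuantumFields.BalabanUV.T4Continuum.B13Base (selfCtr)
open Summit.QuantumFields.BalabanUV.T4Continuum.UrsellTreeSum (ind)
open Summit.QuantumFields.BalabanUV.T4Continuum.B13TermRep (actMajorant norm_term_le_actMajorant)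
open Summit.QuantumFields.BalabanUV.T4Continuum.UrsellTermBudget (actSum summable_actMajorant tsum_actMajorant_le)
open Summit.QuantumFields.BalabanUV.T4Continuum.UrsellTermDecay (summable_actMajorant_of_decay tsum_actMajorant_le_of_decay
  d_le_sum_polys_of_ineq227)
open Summit.QuantumFields.BalabanUV.T4Continuum.B13DomainGeometryTR (SCube footprint reach loc_b13 reach_b13 ineq227_level
  domainGeometry)
open Summit.QuantumFields.BalabanUV.T4Continuum.B13StepOfRecord (Slots assembly step)
open Summit.QuantumFields.BalabanUV.T4Continuum.B13StepOfRecordSub (restrict assemblyOn restrict_act mem_ballClass_onSub_iff)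
open Summit.QuantumFields.BalabanUV.T4Continuum.OutputRateTermwiseLoc (TermBoundLoc TermBudgetLoc)
open Summit.QuantumFields.BalabanUV.T4Continuum.InsertionLinearRate (LinearPair.BaseRate)
open Summit.QuantumFields.BalabanUV.T4Continuum.B13StepEndOn (ne5_of_record_restrict_loc)

/-! ## §1 Generic: the per-domain termwise binders from a uniform activity majorant -/

section Generic

variable {C : Carriers} {ι P J Op Hist : Type*} (𝒯 : TermIndexing C ι P J) (inc : P → P → Prop) [DecidableRel inc]
  (act : P → J → Op → Hist → ℂ)

/-- [folklore] The R21 weight of this module: the combinatorial majorant with the decay factor `e^{−κd X}` taken OUT —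
`actMajorant 𝒯 inc (A k) k X i = (actMajorant 𝒯 inc (A k) k X i · e^{κd X}) · e^{−κd X}`. -/
theorem actMajorant_eq_weight_mul (A : ℕ → P → J → ℝ) (κ : ℝ) (k : ℕ) (i : ι) (X : C.Dom) :
    actMajorant 𝒯 inc (A k) k X i =
      actMajorant 𝒯 inc (A k) k X i * Real.exp (κ * C.d X) * Real.exp (-(κ * C.d X)) := by
  rw [mul_assoc, ← Real.exp_add, add_neg_cancel, Real.exp_zero, mul_one]

/-- [folklore] **R32's `hmaj` SHAPE FOR THIS WEIGHT** (with equality): `actMajorant 𝒯 inc (A k) k X i ≤ a k i X·e^{−κd X}` for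
`a k i X := actMajorant 𝒯 inc (A k) k X i·e^{κd X}`. -/
theorem actMajorant_le_weight (A : ℕ → P → J → ℝ) (κ : ℝ) (k : ℕ) (i : ι) (X : C.Dom) :
    actMajorant 𝒯 inc (A k) k X i ≤
      actMajorant 𝒯 inc (A k) k X i * Real.exp (κ * C.d X) * Real.exp (-(κ * C.d X)) :=
  (actMajorant_eq_weight_mul 𝒯 inc A κ k i X).le

/-- [folklore] **`TermBoundLoc` FOR THE B13 FAMILY FROM A (g,U)-UNIFORM ACTIVITY MAJORANT** ((2.38)-KIND per localized factor,
displayed; uniform in the window and the background as print's bound is on the analyticity domain): at every class point every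
factor of every tuple localizing at a step-`k` domain has `‖act (poly i m) (lab i m) q.1 q.2‖ ≤ A k (poly i m) (lab i m)` ⟹
`TermBoundLoc K (term 𝒯 inc act) W κ (fun k i X => actMajorant 𝒯 inc (A k) k X i · e^{κd X})` — `norm_term_le_actMajorant` and
`e^{κd}·e^{−κd} = 1`. -/
theorem termBoundLoc_b13_of_actBound {K : ℕ → (ℕ → ℝ) → C.BgB → Set (Op × Hist)} {W : Set (ℕ → ℝ)}
    {A : ℕ → P → J → ℝ} {κ : ℝ}
    (hA : ∀ k, ∀ g ∈ W, ∀ (U : C.BgB) (q : Op × Hist), q ∈ K k g U → ∀ X : C.Dom, C.scale X = k →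
      ∀ i, 𝒯.Rel k i X → ∀ m, ‖act (𝒯.poly i m) (𝒯.lab i m) q.1 q.2‖ ≤ A k (𝒯.poly i m) (𝒯.lab i m)) :
    TermBoundLoc K (term 𝒯 inc act) W κ fun k i X => actMajorant 𝒯 inc (A k) k X i * Real.exp (κ * C.d X) := by
  intro k g hg U q hq X hX i
  rw [← actMajorant_eq_weight_mul 𝒯 inc A κ k i X]
  exact norm_term_le_actMajorant (hA k g hg U q hq X hX i)

/-- [folklore] **`TermBudgetLoc` FROM THE PER-DOMAIN BUDGET WITH DECAY** (the g-blind form of `B13TermRep.classBound_b13_of_actBound`'s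
`hbud`; printed KIND (2.39)–(2.41): the sum over the terms with `∪Zᵢ = X` at fixed `X`, decay extracted): `Summable (actMajorant 𝒯 inc
(A k) k X) ∧ Σ' i, actMajorant … k X i ≤ G·e^{−κd X}` at every step-`k` domain ⟹ `TermBudgetLoc (fun k i X => actMajorant 𝒯 inc (A k)
k X i · e^{κd X}) G`. -/
theorem termBudgetLoc_of_actBudgetDecay {A : ℕ → P → J → ℝ} {κ G : ℝ}
    (hbud : ∀ (k : ℕ) (X : C.Dom), C.scale X = k →
      Summable (actMajorant 𝒯 inc (A k) k X) ∧ ∑' i, actMajorant 𝒯 inc (A k) k X i ≤ G * Real.exp (-(κ * C.d X))) :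
    TermBudgetLoc (C := C) (fun k i X => actMajorant 𝒯 inc (A k) k X i * Real.exp (κ * C.d X)) G := by
  intro k X hX
  obtain ⟨hs, hG⟩ := hbud k X hX
  refine ⟨hs.mul_right _, ?_⟩
  rw [tsum_mul_right]
  calc (∑' i, actMajorant 𝒯 inc (A k) k X i) * Real.exp (κ * C.d X)
      ≤ G * Real.exp (-(κ * C.d X)) * Real.exp (κ * C.d X) := mul_le_mul_of_nonneg_right hG (Real.exp_nonneg _)
    _ = G := by rw [mul_assoc, ← Real.exp_add, neg_add_cancel, Real.exp_zero, mul_one]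

end Generic

/-! ## §2 On Bałaban's carriers of record: the per-domain budget from the anchored norm, g-blind and W-free -/

section Record

variable {G : Type} [GaugeGroup G] {R : TwoRuns G}

/-- [folklore] **THE PER-DOMAIN BUDGET WITH RATE ON THE SOCKET OF RECORD, (g,U)-UNIFORM AND WINDOW-FREE** (twin of leaf-01's
`B13StepOfRecordActNorm.actBudget_record_of_actNormDecay` for a majorant that does not depend on the coupling window or the background):
for nonnegative `A, A′ : ℕ → Dom → InnerLabel → ℝ` with the factorwise split `A k ≤ A′ k·e^{−κ(d(Z)+5)}` (`κ ≥ 0`) and the anchored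
exponential norm of `A′ k` on every `R.domAt k` at most `Φ′` for every anchor cube, `36Φ′ < 1`, the combinatorial majorant on the term
indexing ∕ hard core OF RECORD is summable at every step-`k` domain with `Σ' ≤ (Φ′∕(1 − 36Φ′))·e^{−κd(X)}` — leaf-08's `summable_actMajorant`
∕ `tsum_actMajorant_le` (on `A′ k`) and `summable_actMajorant_of_decay` ∕ `tsum_actMajorant_le_of_decay`, with footprint locality, reach
(ν = 9) AND (2.27) (c = 5) DISCHARGED by `B13DomainGeometryTR.loc_b13` ∕ `reach_b13` ∕ `ineq227_level`. -/
theorem actBudget_record_of_actNormDecayU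
    {A A' : ℕ → R.carriers.Dom → InnerLabel R.carriers.Dom (Bnd R) → ℝ} {κ : ℝ} (hκ : 0 ≤ κ)
    (hA0 : ∀ k Z ℓ, 0 ≤ A k Z ℓ) (hA0' : ∀ k Z ℓ, 0 ≤ A' k Z ℓ)
    (hdec : ∀ k Z ℓ, A k Z ℓ ≤ A' k Z ℓ * Real.exp (-(κ * (R.carriers.d Z + 5))))
    {Φ' : ℝ} (hΦ0 : 0 ≤ Φ') (hsmall : 36 * Φ' < 1)
    (hΦ : ∀ (k : ℕ) (q : SCube R),
      ∑ Z ∈ R.domAt k, ind (q ∈ footprint Z) * actSum (b13InnerData R) (A' k) k Z * Real.exp ((footprint Z).card) ≤ Φ') :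
    ∀ (k : ℕ) (X : R.carriers.Dom), R.carriers.scale X = k →
      Summable (actMajorant (labelsIndexing (domainGeometry R) (b13InnerData R)) (touchInc (domainGeometry R)) (A k) k X) ∧
        ∑' i, actMajorant (labelsIndexing (domainGeometry R) (b13InnerData R)) (touchInc (domainGeometry R)) (A k) k X i ≤
          Φ' / (1 - 36 * Φ') * Real.exp (-(κ * R.carriers.d X)) := by
  intro k X hX
  have hsmall' : 4 * 9 * Φ' < 1 := by linarith
  have hgeo : ∀ i : TermIdx R.carriers.Dom (Bnd R), (labelsIndexing (domainGeometry R) (b13InnerData R)).Rel k i X →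
      R.carriers.d X ≤ ∑ m, (R.carriers.d ((labelsIndexing (domainGeometry R) (b13InnerData R)).poly i m) + 5) :=
    fun i hi => d_le_sum_polys_of_ineq227 (domainGeometry R) (b13InnerData R) (by norm_num) (hX ▸ ineq227_level X) i hi
  have hs' := summable_actMajorant (domainGeometry R) (b13InnerData R) (A' k) reach (hA0' k)
    (fun Z Z' h => loc_b13 Z Z' h) (by norm_num) reach_b13 hΦ0 hsmall' (hΦ k) X
  have ht' := tsum_actMajorant_le (domainGeometry R) (b13InnerData R) (A' k) reach (hA0' k)
    (fun Z Z' h => loc_b13 Z Z' h) (by norm_num) reach_b13 hΦ0 hsmall' (hΦ k) X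
  have h36 : (4 : ℝ) * 9 * Φ' = 36 * Φ' := by ring
  rw [h36] at ht'
  exact ⟨summable_actMajorant_of_decay (hA0 k) (hA0' k) hκ (hdec k) hgeo hs',
    tsum_actMajorant_le_of_decay (hA0 k) (hA0' k) hκ (hdec k) hgeo hs' ht'⟩

/-- [folklore] **`TermBudgetLoc` ON THE CARRIERS OF RECORD FROM THE ANCHORED NORM**: under the hypotheses of
`actBudget_record_of_actNormDecayU`, `TermBudgetLoc (fun k i X => actMajorant … (A k) k X i · e^{κd X}) (Φ′∕(1 − 36Φ′))` on the term
indexing ∕ hard core of record — R32's displayed `TermBudgetLoc a G` supplied from the activity-majorant currency, `G` VOLUME-UNIFORM. -/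
theorem termBudgetLoc_record_of_actNormDecayU
    {A A' : ℕ → R.carriers.Dom → InnerLabel R.carriers.Dom (Bnd R) → ℝ} {κ : ℝ} (hκ : 0 ≤ κ)
    (hA0 : ∀ k Z ℓ, 0 ≤ A k Z ℓ) (hA0' : ∀ k Z ℓ, 0 ≤ A' k Z ℓ)
    (hdec : ∀ k Z ℓ, A k Z ℓ ≤ A' k Z ℓ * Real.exp (-(κ * (R.carriers.d Z + 5))))
    {Φ' : ℝ} (hΦ0 : 0 ≤ Φ') (hsmall : 36 * Φ' < 1)
    (hΦ : ∀ (k : ℕ) (q : SCube R),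
      ∑ Z ∈ R.domAt k, ind (q ∈ footprint Z) * actSum (b13InnerData R) (A' k) k Z * Real.exp ((footprint Z).card) ≤ Φ') :
    TermBudgetLoc (C := R.carriers)
      (fun k i X => actMajorant (labelsIndexing (domainGeometry R) (b13InnerData R)) (touchInc (domainGeometry R)) (A k) k X i *
        Real.exp (κ * R.carriers.d X)) (Φ' / (1 - 36 * Φ')) :=
  termBudgetLoc_of_actBudgetDecay (labelsIndexing (domainGeometry R) (b13InnerData R)) (touchInc (domainGeometry R))
    (actBudget_record_of_actNormDecayU hκ hA0 hA0' hdec hΦ0 hsmall hΦ)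

end Record

/-! ## §3 E1 of record (fully local, leaf-09's restrict-Loc face) fired from the activity-majorant currency -/

section End

variable {G : Type} [GaugeGroup G] {R : TwoRuns G} {E IOp Hist : Type*} [NormedAddCommGroup Hist] [NormedSpace ℂ Hist]

/-- [folklore] **THE ACTIVITY MAJORANT MOVED TO THE SUB-SLOT**: a (g,U)-uniform activity majorant of the cores of record `S.act`
displayed on the RECORD class `ballClass (selfCtr (assembly S).raw (assembly S).histRef) ROp RHist` gives `TermBoundLoc` for the
restricted cores `(restrict S M hMA hMB).act` on the SUB-SLOT class (directions in `M` only — R20), with this module's weight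
(`mem_ballClass_onSub_iff`, `restrict_act`, §1). -/
theorem termBoundLoc_restrict_of_actBound (S : Slots R E IOp Hist) (M : Submodule ℂ (OpDatum E))
    (hMA : ∀ g V k, opOf S.F S.rawA g V k ∈ M) (hMB : ∀ g U k, opOf S.F S.rawB g U k ∈ M)
    {W : Set (ℕ → ℝ)} {ROp RHist : ℕ → ℝ} {A : ℕ → R.carriers.Dom → InnerLabel R.carriers.Dom (Bnd R) → ℝ} {κ : ℝ}
    (hA : ∀ k, ∀ g ∈ W, ∀ (U : R.carriers.BgB) (q : OpDatum E × Hist),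
      q ∈ ballClass (selfCtr (assembly S).raw (assembly S).histRef) ROp RHist k g U → ∀ X : R.carriers.Dom,
      R.carriers.scale X = k → ∀ i : TermIdx R.carriers.Dom (Bnd R),
        (labelsIndexing (domainGeometry R) (b13InnerData R)).Rel k i X → ∀ m,
          ‖S.act ((labelsIndexing (domainGeometry R) (b13InnerData R)).poly i m)
            ((labelsIndexing (domainGeometry R) (b13InnerData R)).lab i m) q.1 q.2‖ ≤
            A k ((labelsIndexing (domainGeometry R) (b13InnerData R)).poly i m)
              ((labelsIndexing (domainGeometry R) (b13InnerData R)).lab i m)) :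
    TermBoundLoc (ballClass (selfCtr (assemblyOn (restrict S M hMA hMB)).raw (assemblyOn (restrict S M hMA hMB)).histRef) ROp RHist)
      (term (assemblyOn (restrict S M hMA hMB)).𝒯 (assemblyOn (restrict S M hMA hMB)).inc (restrict S M hMA hMB).act) W κ
      fun k i X => actMajorant (labelsIndexing (domainGeometry R) (b13InnerData R)) (touchInc (domainGeometry R)) (A k) k X i *
        Real.exp (κ * R.carriers.d X) :=
  termBoundLoc_b13_of_actBound (labelsIndexing (domainGeometry R) (b13InnerData R)) (touchInc (domainGeometry R))
    (restrict S M hMA hMB).act fun k g hg U q hq X hX i hi m => by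
      rw [restrict_act]
      exact hA k g hg U ((q.1 : OpDatum E), q.2) ((mem_ballClass_onSub_iff S M hMA hMB _ ROp RHist k g U q.1 q.2).1 hq)
        X hX i hi m

/-- [folklore] **E1 OF RECORD, FULLY LOCAL, FIRED FROM THE ACTIVITY-MAJORANT CURRENCY.**  leaf-09's `B13StepEndOn.ne5_of_record_restrict_loc`
(E1 on the record sub-slot `restrict S M hMA hMB`; termwise data PER DOMAIN) with its two termwise MAJORANT binders DISCHARGED:
`hbd := termBoundLoc_restrict_of_actBound` from (i) a nonnegative (g,U)-UNIFORM activity majorant `A k` of the cores of record `S.act` on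
the record class ((2.38)-KIND, displayed), and `hbud := termBudgetLoc_record_of_actNormDecayU` from (ii) its factorwise split against a
stripped majorant `A′ k` (`A k ≤ A′ k·e^{−κ(d(Z)+5)}`, κ ≥ 0) and (iii) the anchored exponential norm of `A′ k` ≤ Φ′ with `36Φ′ < 1` —
`G := Φ′∕(1 − 36Φ′)`, VOLUME-UNIFORM.  STILL DISPLAYED, AS THERE: the transport reading, the two slice budgets `hbB`∕`hbA` (W3-side), the two
levels (L05∕L06), W1 in row NE2's entry currency + floor, W4 `InsertionRate`, the analyticity half `TermLineAnalytic` on the sub-slot class,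
rooms, numerics (L10 `k₀`∕`B`, L11 `ρ₀`, S).  Conclusion LITERALLY `NE5 (B13StepOfRecord.outA S E₀ cB) (B13StepOfRecord.outB S E₀ cB) W κ θ′
C₅`.  NOT NE5 proved — an implication from displayed binders; for kernel-read slot packages `B13StepEndKernelLoc` §1 feeds
`hbA`∕`hbB`∕`hins` in addition. -/
theorem ne5_of_record_restrict_loc_actNorm (S : Slots R E IOp Hist) (M : Submodule ℂ (OpDatum E))
    (hMA : ∀ g V k, opOf S.F S.rawA g V k ∈ M) (hMB : ∀ g U k, opOf S.F S.rawB g U k ∈ M) {E₀ cB : ℝ}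
    {W : Set (ℕ → ℝ)} {ROp RHist : ℕ → ℝ}
    {A A' : ℕ → R.carriers.Dom → InnerLabel R.carriers.Dom (Bnd R) → ℝ}
    {κ Φ' EA₀ E₁ cA c₁ r₀ δ' θ θ' ρ₀ B : ℝ} {k₀ : ℕ}
    (hT : (assembly S).TransportReads W)
    (hbB : (assembly S).SliceBudgetB W κ cB) (hbA : S.D.SliceBudget (step S E₀ cB) W κ cA)
    (hdA : DecayBound (B13StepOfRecord.outA S E₀ cB) W EA₀ κ) (hdB : DecayBound (B13StepOfRecord.outB S E₀ cB) W E₀ κ)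
    (hRA : RawBounded S.F (assembly S).rawAt W) (hRB : RawBounded S.F S.rawB W)
    (hwer : WeightedEntrywiseRate S.F (assembly S).rawAt S.rawB W c₁ fun k => θ ^ k) (hfl : ∀ k, r₀ ≤ S.rOp k)
    (hins : (step S E₀ cB).InsertionRate W κ E₀ δ' θ)
    (hκ : 0 ≤ κ) (hA0 : ∀ k Z ℓ, 0 ≤ A k Z ℓ) (hA0' : ∀ k Z ℓ, 0 ≤ A' k Z ℓ)
    (hA : ∀ k, ∀ g ∈ W, ∀ (U : R.carriers.BgB) (q : OpDatum E × Hist),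
      q ∈ ballClass (selfCtr (assembly S).raw (assembly S).histRef) ROp RHist k g U → ∀ X : R.carriers.Dom,
      R.carriers.scale X = k → ∀ i : TermIdx R.carriers.Dom (Bnd R),
        (labelsIndexing (domainGeometry R) (b13InnerData R)).Rel k i X → ∀ m,
          ‖S.act ((labelsIndexing (domainGeometry R) (b13InnerData R)).poly i m)
            ((labelsIndexing (domainGeometry R) (b13InnerData R)).lab i m) q.1 q.2‖ ≤
            A k ((labelsIndexing (domainGeometry R) (b13InnerData R)).poly i m)
              ((labelsIndexing (domainGeometry R) (b13InnerData R)).lab i m))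
    (hdec : ∀ k Z ℓ, A k Z ℓ ≤ A' k Z ℓ * Real.exp (-(κ * (R.carriers.d Z + 5))))
    (hΦ0 : 0 ≤ Φ') (hsmallΦ : 36 * Φ' < 1)
    (hΦ : ∀ (k : ℕ) (q : SCube R),
      ∑ Z ∈ R.domAt k, ind (q ∈ footprint Z) * actSum (b13InnerData R) (A' k) k Z * Real.exp ((footprint Z).card) ≤ Φ')
    (hline : TermLineAnalytic (ballClass (selfCtr (assemblyOn (restrict S M hMA hMB)).raw
      (assemblyOn (restrict S M hMA hMB)).histRef) ROp RHist)
      (term (assemblyOn (restrict S M hMA hMB)).𝒯 (assemblyOn (restrict S M hMA hMB)).inc (restrict S M hMA hMB).act) W)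
    (hOp : ∀ k, S.rOp k ≤ ROp k) (hHist : ∀ k, (assembly S).bHist E₀ cB k + S.rHist k ≤ RHist k)
    (hE₀ : 0 ≤ E₀) (hE₁ : 0 < E₁) (hcA : 0 ≤ cA) (hcB : 0 ≤ cB) (hc₁ : 0 ≤ c₁) (hr₀ : 0 < r₀) (hδ' : 0 ≤ δ')
    (hθ : 0 ≤ θ) (hθθ' : θ ≤ θ') (hθ'1 : θ' ≤ 1) (hω : 0 < S.D.ω) (hω1 : S.D.ω < 1) (hρ₀ : ρ₀ < 1)
    (hnear : (c₁ / r₀ + δ') * θ ^ k₀ + cA * (EA₀ + E₀) / (1 - S.D.ω) ≤ ρ₀) (hB : 0 ≤ B)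
    (hfirst : ∀ k < k₀, EA₀ + E₀ ≤ B * θ ^ k)
    (hsmall : S.D.ω + Φ' / (1 - 36 * Φ') / (1 - ρ₀) * cA < θ') :
    NE5 (B13StepOfRecord.outA S E₀ cB) (B13StepOfRecord.outB S E₀ cB) W κ θ'
      ((Φ' / (1 - 36 * Φ') / (1 - ρ₀) * (c₁ / r₀) + Φ' / (1 - 36 * Φ') / (1 - ρ₀) * δ' + B) * (θ' - S.D.ω) /
        (θ' - (S.D.ω + Φ' / (1 - 36 * Φ') / (1 - ρ₀) * cA))) :=
  ne5_of_record_restrict_loc S M hMA hMB E₀ cB hT hbB hbA hdA hdB hRA hRB hwer hfl hins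
    (termBoundLoc_restrict_of_actBound S M hMA hMB hA) (termBudgetLoc_record_of_actNormDecayU hκ hA0 hA0' hdec hΦ0 hsmallΦ hΦ)
    hline hOp hHist hE₀ hE₁ (div_nonneg hΦ0 (by linarith)) hcA hcB hc₁ hr₀ hδ' hθ hθθ' hθ'1 hω hω1 hρ₀ hnear hB hfirst hsmall

end End

end Summit.QuantumFields.BalabanUV.T4Continuum.B13TermRepLoc

end
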